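import Mathlib
import Summits.Ventures.HodgeRepro.Tier4.Target
import Summits.Ventures.HodgeRepro.Tier4.Line3.Defs
import Summits.Ventures.HodgeRepro.Tier4.Line3.DefsLemmas
import Summits.Ventures.HodgeRepro.Tier4.Line3.BallCoordLemmas
import Summits.Ventures.HodgeRepro.Tier4.Line3.LocSScalarObstruction
import Summits.Ventures.HodgeRepro.Tier4.Line3.GaussRatioFormula
import Summits.Ventures.HodgeRepro.Tier4.Line3.CopyWeightGaussian
import Summits.Ventures.HodgeRepro.Tier4.Line3.CopyCountShrink
import Summits.Ventures.HodgeRepro.Tier4.Line3.QuarticProfile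
import Summits.Ventures.HodgeRepro.Tier4.Line3.RatioWindow

/-!
# Tier4/Line3/WindowCentre — a centre in the closed quartic window by per-slot unit powers, the four centre clauses kept

Blind re-derivation cell `pub-hodge-repro`, Tier 4 «PROVE THE STEP», LINE L3, seat t4-L3-p2 (g3): the cut
C-L3-WINDOWCENTRE of the line's planner (STATUS S14240 / S14274 / S14304), by name on x2's `RatioWindow`
(`exists_zpow_smul_ratio_mem_window`, `ratio_smul`, `tauSize_smul`), `ballCoord_smul` (BallCoordLemmas), `hform_smul`
(DefsLemmas), `defQuad_smul` (GaussRatioFormula), `defQuad_conjEmb` (QuarticProfile) and `ne_zero_of_wedge`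
(LocSScalarObstruction).

* A scalar `a ≠ 0` on a slot multiplies its ball coordinates by `τ₀ a` (`ballCoord_smul`): the wedge of two slots scales by
  `τ₀ a · τ₀ b` (`wedge_scaled`, `wedge_scaled_ne`), the span of the two ball vectors — the plane whose `J`-positivity is the
  centre's third clause — is unchanged (`jpos_scaled`), and the `(0,1)` Gram entry scales by `c(a) b` (`gram_scaled_ne`).
* `exists_unitScaled_closed_window`: from a symmetric `J`-positive centre with wedge `≠ 0` and `gram 0 1 ≠ 0` and a unit `u`
  with `‖τ₀ u‖² = η₀`, `‖σ u‖² = 1/η₀` at a definite embedding `σ`, the per-slot unit powers `xm' j = u^(k j) • xm j` with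
  `k 2 = k 0`, `k 3 = k 1` (x2's `k` at the slots `0` and `1`, copied to the symmetric slots) give a centre with the four
  clauses whose slot ratios `2 q_σ / h` all lie in the CLOSED window `[1/η₀, η₀]`.
* `exists_unitScaled_closed_window_quartic`: the same at EVERY definite embedding on a field of the quartic shape
  (`defEmb = {σ₁, conjEmb σ₁}`, `defQuad_conjEmb`: one `k` per slot serves both).
* `exists_unitScaled_quarticWindow`: the OPEN window with the discriminant clause — the three clauses of the skeleton's
  `QuarticWindow` verbatim — under two further displayed hypotheses: `η₀² − 6 η₀ + 1 ≤ 0` (i.e. `η₀ ≤ 3 + 2√2`, on which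
  the open window `(1/η₀, η₀) ⊆ (3 − 2√2, 3 + 2√2)` makes the discriminant clause automatic, `disc_neg_of_open_window`)
  and the non-boundary clause «no slot ratio of `xm` is an odd power of `η₀`» — necessary for this unit, not a convenience:
  a unit power moves a ratio by `η₀^(−2k)` (`ratio_zpow_smul`), so the orbit of an odd power of `η₀` sits on the boundary
  `{1/η₀, η₀}` for every `k`.

Nothing here says anything about the status of the Hodge conjecture for CM abelian varieties, which is NOT proved
(HC_CM is NOT proved by anyone in this repository).
-/

set_option autoImplicit false

noncomputable section

namespace Summit.Ventures.HodgeRepro.Tier4.Line3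

open Summit.Ventures.HodgeRepro.Tier4
open Matrix NumberField
open scoped ComplexConjugate
open scoped Classical

/-! ## A. Two real lemmas -/

/-- **THE DISCRIMINANT CLAUSE IS AUTOMATIC ON THE OPEN WINDOW** when `η₀ ≤ 3 + 2√2` (root-free: `η₀² − 6 η₀ + 1 ≤ 0`):
for `h, q > 0` with `1/η₀ < 2q/h < η₀`, `h² − 12 h q + 4 q² < 0`. -/
theorem disc_neg_of_open_window {h q η₀ : ℝ} (hh : 0 < h) (hq : 0 < q) (hη : 1 < η₀)
    (hη6 : η₀ ^ 2 - 6 * η₀ + 1 ≤ 0) (hr1 : 1 / η₀ < 2 * q / h) (hr2 : 2 * q / h < η₀) :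
    h ^ 2 - 12 * h * q + 4 * q ^ 2 < 0 := by
  have hη0 : 0 < η₀ := by linarith
  have h1 : h < 2 * q * η₀ := by
    rw [div_lt_div_iff₀ hη0 hh] at hr1
    linarith
  have h2 : 2 * q < η₀ * h := by
    rw [div_lt_iff₀ hh] at hr2
    linarith
  have hprod := mul_pos (sub_pos.2 h1) (sub_pos.2 h2)
  have hqh : 0 ≤ 2 * q * h := by positivity
  have hkey : η₀ * (h ^ 2 - 12 * h * q + 4 * q ^ 2) < 0 := by
    nlinarith [mul_nonneg hqh (by linarith : (0 : ℝ) ≤ 6 * η₀ - η₀ ^ 2 - 1)]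
  nlinarith

/-- A closed-window value that is neither endpoint is in the open window. -/
theorem open_of_closed_window {r η₀ : ℝ} (h1 : 1 / η₀ ≤ r) (h2 : r ≤ η₀) (hne1 : r ≠ 1 / η₀) (hne2 : r ≠ η₀) :
    1 / η₀ < r ∧ r < η₀ :=
  ⟨lt_of_le_of_ne h1 (Ne.symm hne1), lt_of_le_of_ne h2 hne2⟩

namespace T4Data

variable (X : T4Data)

/-! ## B. The slot `1` is non-zero, and the clauses under per-slot scalars -/

/-- The wedge clause of the line's tuples forces `xm 1 ≠ 0` (companion of `ne_zero_of_wedge`, LocSScalarObstruction). -/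
theorem slot1_ne_zero_of_wedge {xm : X.Tuple}
    (hab : X.ballCoord (xm 0) 0 * X.ballCoord (xm 1) 1 - X.ballCoord (xm 0) 1 * X.ballCoord (xm 1) 0 ≠ 0) :
    xm 1 ≠ 0 := fun h1 => hab (by rw [h1, X.ballCoord_zero]; simp)

/-- A slot's ball coordinate scales by `τ₀ a` under the scalar `a` (`ballCoord_smul`, pointwise). -/
theorem ballCoord_smul_apply (a : X.E) (x : Fin 3 → X.E) (i : Fin 3) :
    X.ballCoord (a • x) i = X.τ₀ a * X.ballCoord x i := by
  rw [X.ballCoord_smul, Pi.smul_apply, smul_eq_mul]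

/-- The wedge of two scaled slots is `τ₀ a · τ₀ b` times the wedge. -/
theorem wedge_scaled (a b : X.E) (x y : Fin 3 → X.E) :
    X.ballCoord (a • x) 0 * X.ballCoord (b • y) 1 - X.ballCoord (a • x) 1 * X.ballCoord (b • y) 0 =
      (X.τ₀ a * X.τ₀ b) * (X.ballCoord x 0 * X.ballCoord y 1 - X.ballCoord x 1 * X.ballCoord y 0) := by
  simp only [ballCoord_smul_apply]
  ring

/-- The wedge clause is kept by non-zero scalars on the two slots. -/
theorem wedge_scaled_ne {a b : X.E} (ha : a ≠ 0) (hb : b ≠ 0) {x y : Fin 3 → X.E}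
    (hab : X.ballCoord x 0 * X.ballCoord y 1 - X.ballCoord x 1 * X.ballCoord y 0 ≠ 0) :
    X.ballCoord (a • x) 0 * X.ballCoord (b • y) 1 - X.ballCoord (a • x) 1 * X.ballCoord (b • y) 0 ≠ 0 := by
  rw [wedge_scaled]
  exact mul_ne_zero (mul_ne_zero ((map_ne_zero X.τ₀).2 ha) ((map_ne_zero X.τ₀).2 hb)) hab

/-- The `J`-positivity of the plane is kept by non-zero scalars on the two slots: the plane is the same. -/
theorem jpos_scaled {a b : X.E} (ha : a ≠ 0) (hb : b ≠ 0) {x y : Fin 3 → X.E}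
    (hpos : ∀ u v : ℂ, (u ≠ 0 ∨ v ≠ 0) →
      0 < (star (u • X.ballCoord x + v • X.ballCoord y) ⬝ᵥ (J *ᵥ (u • X.ballCoord x + v • X.ballCoord y))).re) :
    ∀ u v : ℂ, (u ≠ 0 ∨ v ≠ 0) →
      0 < (star (u • X.ballCoord (a • x) + v • X.ballCoord (b • y)) ⬝ᵥ
        (J *ᵥ (u • X.ballCoord (a • x) + v • X.ballCoord (b • y)))).re := by
  intro u v huv
  have he : u • X.ballCoord (a • x) + v • X.ballCoord (b • y) =
      (u * X.τ₀ a) • X.ballCoord x + (v * X.τ₀ b) • X.ballCoord y := by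
    rw [X.ballCoord_smul, X.ballCoord_smul, smul_smul, smul_smul]
  rw [he]
  refine hpos _ _ ?_
  rcases huv with hu | hv
  · exact Or.inl (mul_ne_zero hu ((map_ne_zero X.τ₀).2 ha))
  · exact Or.inr (mul_ne_zero hv ((map_ne_zero X.τ₀).2 hb))

/-- The `(0,1)` Gram clause is kept by non-zero scalars on the two slots (`hform_smul`). -/
theorem gram_scaled_ne {xm xm' : X.Tuple} {a b : X.E} (ha : a ≠ 0) (hb : b ≠ 0)
    (h0 : xm' 0 = a • xm 0) (h1 : xm' 1 = b • xm 1) (hB : X.gram xm 0 1 ≠ 0) : X.gram xm' 0 1 ≠ 0 := by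
  show hform X.c X.H (xm' 0) (xm' 1) ≠ 0
  rw [h0, h1, X.hform_smul]
  exact mul_ne_zero (mul_ne_zero (X.c.map_ne_zero_iff.2 ha) hb) hB

/-- **A UNIT POWER MOVES THE SLOT RATIO BY `η₀^(−2k)`** (`ratio_smul` with `‖σ (u^k)‖² = η₀^(−k)`, `‖τ₀ (u^k)‖² = η₀^k`). -/
theorem ratio_zpow_smul (σ : X.E →+* ℂ) {u : X.E} (hu : u ≠ 0) {η₀ : ℝ} (hη : 1 < η₀)
    (hu1 : ‖X.τ₀ u‖ ^ 2 = η₀) (hu2 : ‖σ u‖ ^ 2 = 1 / η₀) {x : Fin 3 → X.E} (hx : x ≠ 0) (k : ℤ) :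
    2 * X.defQuad σ (u ^ k • x) / X.tauSize (u ^ k • x) =
      η₀ ^ (-(2 * k)) * (2 * X.defQuad σ x / X.tauSize x) := by
  have hη0 : 0 < η₀ := by linarith
  rw [X.ratio_smul σ (zpow_ne_zero _ hu) x hx]
  congr 1
  have e1 : ‖σ (u ^ k)‖ ^ (2 : ℕ) = (‖σ u‖ ^ (2 : ℕ)) ^ k := by
    rw [map_zpow₀, norm_zpow, ← zpow_natCast, ← zpow_natCast, ← _root_.zpow_mul, ← _root_.zpow_mul, mul_comm]
  have e2 : ‖X.τ₀ (u ^ k)‖ ^ (2 : ℕ) = (‖X.τ₀ u‖ ^ (2 : ℕ)) ^ k := by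
    rw [map_zpow₀, norm_zpow, ← zpow_natCast, ← zpow_natCast, ← _root_.zpow_mul, ← _root_.zpow_mul, mul_comm]
  rw [e1, e2, hu1, hu2, one_div, _root_.inv_zpow, div_eq_mul_inv, ← _root_.zpow_neg, ← zpow_add₀ hη0.ne']
  congr 1
  ring

/-! ## C. The centre in the closed window -/

/-- **C-L3-WINDOWCENTRE (one definite embedding):** from a symmetric `J`-positive centre `xm` with wedge `≠ 0` and
`gram 0 1 ≠ 0`, and a unit `u` with `‖τ₀ u‖² = η₀ > 1` and `‖σ u‖² = 1/η₀` at the definite embedding `σ`, the per-slot unit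
powers `xm' j = u^(k j) • xm j` (with `k 2 = k 0`, `k 3 = k 1`) give a centre with the four clauses whose slot ratios
`2 q_σ / h` all lie in the CLOSED window `[1/η₀, η₀]` (x2's `exists_zpow_smul_ratio_mem_window` at the slots `0`, `1`). -/
theorem exists_unitScaled_closed_window (σ : X.E →+* ℂ) (hσ : σ ∈ X.defEmb) {u : X.E} (hu : u ≠ 0)
    {η₀ : ℝ} (hη : 1 < η₀) (hu1 : ‖X.τ₀ u‖ ^ 2 = η₀) (hu2 : ‖σ u‖ ^ 2 = 1 / η₀)
    {xm : X.Tuple} (h02 : xm 2 = xm 0) (h13 : xm 3 = xm 1)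
    (hab : X.ballCoord (xm 0) 0 * X.ballCoord (xm 1) 1 - X.ballCoord (xm 0) 1 * X.ballCoord (xm 1) 0 ≠ 0)
    (hpos : ∀ u v : ℂ, (u ≠ 0 ∨ v ≠ 0) →
      0 < (star (u • X.ballCoord (xm 0) + v • X.ballCoord (xm 1)) ⬝ᵥ
        (J *ᵥ (u • X.ballCoord (xm 0) + v • X.ballCoord (xm 1)))).re)
    (hB : X.gram xm 0 1 ≠ 0) :
    ∃ xm' : X.Tuple, (∃ k : Fin 4 → ℤ, k 2 = k 0 ∧ k 3 = k 1 ∧ ∀ j, xm' j = u ^ (k j) • xm j) ∧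
      xm' 2 = xm' 0 ∧ xm' 3 = xm' 1 ∧
      X.ballCoord (xm' 0) 0 * X.ballCoord (xm' 1) 1 - X.ballCoord (xm' 0) 1 * X.ballCoord (xm' 1) 0 ≠ 0 ∧
      (∀ u v : ℂ, (u ≠ 0 ∨ v ≠ 0) →
        0 < (star (u • X.ballCoord (xm' 0) + v • X.ballCoord (xm' 1)) ⬝ᵥ
          (J *ᵥ (u • X.ballCoord (xm' 0) + v • X.ballCoord (xm' 1)))).re) ∧
      X.gram xm' 0 1 ≠ 0 ∧
      ∀ j, 1 / η₀ ≤ 2 * X.defQuad σ (xm' j) / X.tauSize (xm' j) ∧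
        2 * X.defQuad σ (xm' j) / X.tauSize (xm' j) ≤ η₀ := by
  have hx0 : xm 0 ≠ 0 := X.ne_zero_of_wedge hab
  have hx1 : xm 1 ≠ 0 := X.slot1_ne_zero_of_wedge hab
  obtain ⟨k0, hk0⟩ := X.exists_zpow_smul_ratio_mem_window σ hu hη hu1 hu2 hx0 (X.defQuad_pos hσ hx0)
  obtain ⟨k1, hk1⟩ := X.exists_zpow_smul_ratio_mem_window σ hu hη hu1 hu2 hx1 (X.defQuad_pos hσ hx1)
  set k : Fin 4 → ℤ := ![k0, k1, k0, k1] with hk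
  set xm' : X.Tuple := fun j => u ^ (k j) • xm j with hxm'
  have e0 : xm' 0 = u ^ k0 • xm 0 := rfl
  have e1 : xm' 1 = u ^ k1 • xm 1 := rfl
  have e2 : xm' 2 = u ^ k0 • xm 0 := by
    show u ^ k0 • xm 2 = u ^ k0 • xm 0
    rw [h02]
  have e3 : xm' 3 = u ^ k1 • xm 1 := by
    show u ^ k1 • xm 3 = u ^ k1 • xm 1
    rw [h13]
  refine ⟨xm', ⟨k, rfl, rfl, fun j => rfl⟩, e2.trans e0.symm, e3.trans e1.symm, ?_, ?_, ?_, ?_⟩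
  · rw [e0, e1]
    exact X.wedge_scaled_ne (zpow_ne_zero _ hu) (zpow_ne_zero _ hu) hab
  · rw [e0, e1]
    exact X.jpos_scaled (zpow_ne_zero _ hu) (zpow_ne_zero _ hu) hpos
  · exact X.gram_scaled_ne (zpow_ne_zero _ hu) (zpow_ne_zero _ hu) e0 e1 hB
  · intro j
    match j with
    | 0 => rw [e0]; exact hk0
    | 1 => rw [e1]; exact hk1
    | 2 => rw [e2]; exact hk0
    | 3 => rw [e3]; exact hk1

/-- **C-L3-WINDOWCENTRE (quartic shape, every definite embedding):** on a field of the quartic shape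
(`defEmb = {σ₁, conjEmb σ₁}`), with `‖σ u‖² = 1/η₀` at every definite embedding, the centre of
`exists_unitScaled_closed_window` is in the closed window at EVERY definite embedding — one `k` per slot serves both
conjugate embeddings (`defQuad_conjEmb`). -/
theorem exists_unitScaled_closed_window_quartic (hQ : X.QuarticShape) {u : X.E} (hu : u ≠ 0)
    {η₀ : ℝ} (hη : 1 < η₀) (hu1 : ‖X.τ₀ u‖ ^ 2 = η₀) (hu2 : ∀ σ ∈ X.defEmb, ‖σ u‖ ^ 2 = 1 / η₀)
    {xm : X.Tuple} (h02 : xm 2 = xm 0) (h13 : xm 3 = xm 1)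
    (hab : X.ballCoord (xm 0) 0 * X.ballCoord (xm 1) 1 - X.ballCoord (xm 0) 1 * X.ballCoord (xm 1) 0 ≠ 0)
    (hpos : ∀ u v : ℂ, (u ≠ 0 ∨ v ≠ 0) →
      0 < (star (u • X.ballCoord (xm 0) + v • X.ballCoord (xm 1)) ⬝ᵥ
        (J *ᵥ (u • X.ballCoord (xm 0) + v • X.ballCoord (xm 1)))).re)
    (hB : X.gram xm 0 1 ≠ 0) :
    ∃ xm' : X.Tuple, (∃ k : Fin 4 → ℤ, k 2 = k 0 ∧ k 3 = k 1 ∧ ∀ j, xm' j = u ^ (k j) • xm j) ∧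
      xm' 2 = xm' 0 ∧ xm' 3 = xm' 1 ∧
      X.ballCoord (xm' 0) 0 * X.ballCoord (xm' 1) 1 - X.ballCoord (xm' 0) 1 * X.ballCoord (xm' 1) 0 ≠ 0 ∧
      (∀ u v : ℂ, (u ≠ 0 ∨ v ≠ 0) →
        0 < (star (u • X.ballCoord (xm' 0) + v • X.ballCoord (xm' 1)) ⬝ᵥ
          (J *ᵥ (u • X.ballCoord (xm' 0) + v • X.ballCoord (xm' 1)))).re) ∧
      X.gram xm' 0 1 ≠ 0 ∧
      ∀ j, ∀ σ ∈ X.defEmb, 1 / η₀ ≤ 2 * X.defQuad σ (xm' j) / X.tauSize (xm' j) ∧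
        2 * X.defQuad σ (xm' j) / X.tauSize (xm' j) ≤ η₀ := by
  obtain ⟨σ₁, hσ, hdef⟩ := hQ
  have hσ₁ : σ₁ ∈ X.defEmb := by rw [hdef]; exact Finset.mem_insert_self _ _
  obtain ⟨xm', hk, h02', h13', hab', hpos', hB', hwin⟩ :=
    X.exists_unitScaled_closed_window σ₁ hσ₁ hu hη hu1 (hu2 σ₁ hσ₁) h02 h13 hab hpos hB
  refine ⟨xm', hk, h02', h13', hab', hpos', hB', fun j σ hσj => ?_⟩
  rw [hdef, Finset.mem_insert, Finset.mem_singleton] at hσj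
  rcases hσj with rfl | rfl
  · exact hwin j
  · rw [X.defQuad_conjEmb]
    exact hwin j

/-! ## D. The open window with the discriminant clause (offered; the three clauses of the skeleton's `QuarticWindow`) -/

/-- **A CENTRE IN THE QUARTIC WINDOW** (the three clauses of the skeleton's `QuarticWindow xm' η₀` verbatim) from the
closed-window centre, under `η₀² − 6 η₀ + 1 ≤ 0` (`η₀ ≤ 3 + 2√2`; the discriminant clause is then automatic on the open
window, `disc_neg_of_open_window`) and the non-boundary clause «no slot ratio of `xm` at a definite embedding is an odd power
of `η₀`» (necessary for this unit: a unit power moves a ratio by `η₀^(−2k)`, `ratio_zpow_smul`, so an odd power of `η₀`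
stays on the boundary `{1/η₀, η₀}` for every `k`). -/
theorem exists_unitScaled_quarticWindow (hQ : X.QuarticShape) {u : X.E} (hu : u ≠ 0)
    {η₀ : ℝ} (hη : 1 < η₀) (hη6 : η₀ ^ 2 - 6 * η₀ + 1 ≤ 0)
    (hu1 : ‖X.τ₀ u‖ ^ 2 = η₀) (hu2 : ∀ σ ∈ X.defEmb, ‖σ u‖ ^ 2 = 1 / η₀)
    {xm : X.Tuple} (h02 : xm 2 = xm 0) (h13 : xm 3 = xm 1)
    (hab : X.ballCoord (xm 0) 0 * X.ballCoord (xm 1) 1 - X.ballCoord (xm 0) 1 * X.ballCoord (xm 1) 0 ≠ 0)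
    (hpos : ∀ u v : ℂ, (u ≠ 0 ∨ v ≠ 0) →
      0 < (star (u • X.ballCoord (xm 0) + v • X.ballCoord (xm 1)) ⬝ᵥ
        (J *ᵥ (u • X.ballCoord (xm 0) + v • X.ballCoord (xm 1)))).re)
    (hB : X.gram xm 0 1 ≠ 0)
    (hodd : ∀ j, ∀ σ ∈ X.defEmb, ∀ k : ℤ, 2 * X.defQuad σ (xm j) / X.tauSize (xm j) ≠ η₀ ^ (2 * k + 1)) :
    ∃ xm' : X.Tuple, (∃ k : Fin 4 → ℤ, k 2 = k 0 ∧ k 3 = k 1 ∧ ∀ j, xm' j = u ^ (k j) • xm j) ∧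
      xm' 2 = xm' 0 ∧ xm' 3 = xm' 1 ∧
      X.ballCoord (xm' 0) 0 * X.ballCoord (xm' 1) 1 - X.ballCoord (xm' 0) 1 * X.ballCoord (xm' 1) 0 ≠ 0 ∧
      (∀ u v : ℂ, (u ≠ 0 ∨ v ≠ 0) →
        0 < (star (u • X.ballCoord (xm' 0) + v • X.ballCoord (xm' 1)) ⬝ᵥ
          (J *ᵥ (u • X.ballCoord (xm' 0) + v • X.ballCoord (xm' 1)))).re) ∧
      X.gram xm' 0 1 ≠ 0 ∧
      (∀ j, ∀ σ ∈ X.defEmb, 1 / η₀ < 2 * X.defQuad σ (xm' j) / X.tauSize (xm' j)) ∧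
      (∀ j, ∀ σ ∈ X.defEmb, 2 * X.defQuad σ (xm' j) / X.tauSize (xm' j) < η₀) ∧
      (∀ j, ∀ σ ∈ X.defEmb,
        X.tauSize (xm' j) ^ 2 - 12 * X.tauSize (xm' j) * X.defQuad σ (xm' j) + 4 * X.defQuad σ (xm' j) ^ 2 < 0) := by
  have hη0 : 0 < η₀ := by linarith
  have hx : ∀ j, xm j ≠ 0 := by
    have h0 : xm 0 ≠ 0 := X.ne_zero_of_wedge hab
    have h1 : xm 1 ≠ 0 := X.slot1_ne_zero_of_wedge hab
    intro j
    match j with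
    | 0 => exact h0
    | 1 => exact h1
    | 2 => rw [h02]; exact h0
    | 3 => rw [h13]; exact h1
  obtain ⟨xm', ⟨k, hk2, hk3, hk⟩, h02', h13', hab', hpos', hB', hwin⟩ :=
    X.exists_unitScaled_closed_window_quartic hQ hu hη hu1 hu2 h02 h13 hab hpos hB
  -- the open window at every slot and definite embedding
  have hopen : ∀ j, ∀ σ ∈ X.defEmb, 1 / η₀ < 2 * X.defQuad σ (xm' j) / X.tauSize (xm' j) ∧
      2 * X.defQuad σ (xm' j) / X.tauSize (xm' j) < η₀ := by
    intro j σ hσ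
    obtain ⟨hw1, hw2⟩ := hwin j σ hσ
    have hrat : 2 * X.defQuad σ (xm' j) / X.tauSize (xm' j) =
        η₀ ^ (-(2 * k j)) * (2 * X.defQuad σ (xm j) / X.tauSize (xm j)) := by
      rw [hk j]
      exact X.ratio_zpow_smul σ hu hη hu1 (hu2 σ hσ) (hx j) (k j)
    have hrec : 2 * X.defQuad σ (xm j) / X.tauSize (xm j) =
        η₀ ^ (2 * k j) * (2 * X.defQuad σ (xm' j) / X.tauSize (xm' j)) := by
      rw [hrat, ← mul_assoc, ← zpow_add₀ hη0.ne', add_neg_cancel, zpow_zero, one_mul]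
    refine open_of_closed_window hw1 hw2 ?_ ?_
    · intro heq
      refine hodd j σ hσ (k j - 1) ?_
      rw [hrec, heq, show 2 * (k j - 1) + 1 = 2 * k j + (-1) by ring, zpow_add₀ hη0.ne', _root_.zpow_neg_one, one_div]
    · intro heq
      refine hodd j σ hσ (k j) ?_
      rw [hrec, heq, zpow_add_one₀ hη0.ne']
  refine ⟨xm', ⟨k, hk2, hk3, hk⟩, h02', h13', hab', hpos', hB', fun j σ hσ => (hopen j σ hσ).1,
    fun j σ hσ => (hopen j σ hσ).2, fun j σ hσ => ?_⟩
  have hx' : xm' j ≠ 0 := by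
    rw [hk j]
    exact smul_ne_zero (zpow_ne_zero _ hu) (hx j)
  exact disc_neg_of_open_window (X.tauSize_pos hx') (X.defQuad_pos hσ hx') hη hη6 (hopen j σ hσ).1 (hopen j σ hσ).2

end T4Data

end Summit.Ventures.HodgeRepro.Tier4.Line3

end
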